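import Literature.Topology.FourManifolds.IwaseToriZoneV
import Literature.Topology.FourManifolds.IwaseToriLoop
import Literature.Topology.FourManifolds.IwaseHandlePhi
import HarnessLib

/-!
# The handle zone of the Iwase tori

Part of the construction of the tubular neighbourhood maps of the model datum in the proof of
Iwase's Proposition 3.5 [cite: Iwase1988, Prop. 3.5, p. 296].  Over the *handle zone* the first
torus is the handle chart applied to the adapted tube of the unknot surgery model:
`TH (z, t, ν) = h (loopU t, tube (m(loopU t)) (toC z) (n'(ν)))`, `n'(ν) = 1 - e^{-ν}`.

* `nprime` and its elementary properties; `tube_nprime : tube m z n' = (√(1 + q/m) z, Im ν)`;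
* `zoneH`, `GH`, `TH`, `GH_mem_Ubox`, `TH_mem_Hset`, `GH_snd_mem_unknot_iff`, `TH_zero`;
* `handlePD` (the handle chart `h : Ubox ≅ Hset` as a partial diffeomorphism), `GHPD` (the handle
  parameters as a partial diffeomorphism, explicit inverse `GHinv`), `isLocalDiffeomorphAt_TH`;
* **the overlap identity** `TH_eq_TV` on the junction `√(49/50) < t`, `t² < 491/500` (there the
  handle chart is the cylindrical chart with `k² = 1 - t²`, `k² ρ² = X`, and the graph-zone fibre
  is the pure slice fibre `W = t² e^{i Im ν}`, `WV_junction`);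
* **exactness** `PhiH_TH_shear : Φ_H (TH (unit(v)·z, t, ν(v))) = TH1 (z, t, ν(v))` (`v ≠ 0`), the
  exact tube relation `theta_tube` of the slice model transported by the handle chart, with
  `TH1 = G⁻¹ ∘ TH ∘ (rotH ·)`, `rotH ν = circleOf (nrm (e^{-ν} E(ν)))⁻¹` smooth.

All statements are elementary [folklore].

## References
* Z. Iwase, *Dehn-surgery along a torus T²-knot*, Pacific J. Math. 133 (1988), 289–299,
  Prop. 3.5. [cite: Iwase1988]
-/

open scoped ContDiff Topology Manifold
open Set Function Real Filter Metric

noncomputable section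

namespace Literature.Topology.FourManifolds

namespace IwaseTori

open IwaseHandle UnknotSurgery

/-! ### The normal coordinate of the handle tube: `n' = 1 - e^{-ν}` -/

/-- **The handle normal coordinate** `n'(ν) = 1 - e^{-ν}`. [folklore] -/
def nprime (ν : ℂ) : ℂ := 1 - Complex.exp (-ν)

/-- `1 - n' = e^{-ν}`. [folklore] -/
@[simp] theorem one_sub_nprime (ν : ℂ) : 1 - nprime ν = Complex.exp (-ν) := by simp [nprime]

/-- `n'(0) = 0`. [folklore] -/
@[simp] theorem nprime_zero : nprime 0 = 0 := by simp [nprime]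

/-- `‖1 - n'‖ = e^{-Re ν}`. [folklore] -/
theorem norm_one_sub_nprime (ν : ℂ) : ‖1 - nprime ν‖ = Real.exp (-ν.re) := by
  rw [one_sub_nprime, Complex.norm_exp, Complex.neg_re]

/-- `1 - ‖1 - n'‖ = q(ν)`. [folklore] -/
theorem one_sub_norm_nprime (ν : ℂ) : 1 - ‖1 - nprime ν‖ = qOf ν := by
  rw [norm_one_sub_nprime, qOf]

/-- `arg (1 - n') = -Im ν` for `|Im ν| < π`. [folklore] -/
theorem arg_one_sub_nprime {ν : ℂ} (hν : |ν.im| < π) : Complex.arg (1 - nprime ν) = -ν.im := by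
  obtain ⟨h1, h2⟩ := abs_lt.1 hν
  rw [one_sub_nprime, Complex.arg_exp, Complex.neg_im, toIocMod_eq_self]
  exact ⟨by linarith, by linarith⟩

/-- `n' = ν · (e^{-ν} E(ν))`. [folklore] -/
theorem nprime_eq (ν : ℂ) : nprime ν = ν * (Complex.exp (-ν) * Efun ν) := by
  have h := mul_Efun ν
  rw [nprime]
  calc (1 : ℂ) - Complex.exp (-ν) = Complex.exp (-ν) * (Complex.exp ν - 1) := by
        rw [mul_sub, ← Complex.exp_add, neg_add_cancel, Complex.exp_zero, mul_one]
    _ = ν * (Complex.exp (-ν) * Efun ν) := by rw [← h]; ring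

/-- `n' = 0 ↔ ν = 0` for `‖ν‖ < 1`. [folklore] -/
theorem nprime_eq_zero_iff {ν : ℂ} (hν : ‖ν‖ < 1) : nprime ν = 0 ↔ ν = 0 := by
  rw [nprime_eq, mul_eq_zero, mul_eq_zero]
  have h1 : Complex.exp (-ν) ≠ 0 := Complex.exp_ne_zero _
  have h2 : Efun ν ≠ 0 := Efun_ne_zero hν
  simp [h1, h2]

/-- `‖n'‖ ≤ 2 ‖ν‖` for `‖ν‖ ≤ 1`. [folklore] -/
theorem norm_nprime_le {ν : ℂ} (hν : ‖ν‖ ≤ 1) : ‖nprime ν‖ ≤ 2 * ‖ν‖ := by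
  have h := Complex.norm_exp_sub_one_le (x := -ν) (by rwa [norm_neg])
  rw [norm_neg] at h
  rw [nprime, norm_sub_rev]; exact h

/-- `n'` is smooth. [folklore] -/
theorem contDiff_nprime : ContDiff ℝ ∞ nprime :=
  contDiff_const.sub (Complex.contDiff_exp.comp contDiff_neg)

/-- **The handle tube point in terms of `ν`**: `tube m z n' = (√(1 + q/m) z, Im ν)`. [folklore] -/
theorem tube_nprime {m : ℝ} (z : ℂ) {ν : ℂ} (hν : |ν.im| < π) :
    tube m z (nprime ν) = (↑(Real.sqrt (1 + qOf ν / m)) * z, ν.im) := by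
  rw [tube, one_sub_norm_nprime, arg_one_sub_nprime hν, neg_neg]

/-! ### The handle zone and its map -/

/-- **The handle zone** of the loop coordinate: `t ∈ (√(49/50), 4 - √(49/50))`. [folklore] -/
def zoneH (t : ℝ) : Prop := Real.sqrt (49 / 50) < t ∧ t < 4 - Real.sqrt (49 / 50)

/-- The handle parameters of a point of the handle zone:
`GH (z, t, ν) = (loopU t, tube (m(loopU t)) (toC z) (n'(ν)))`. [folklore] -/
def GH (p : sphere (0 : EuclideanSpace ℝ (Fin 2)) 1 × ℝ × ℂ) : ℝ × ℂ × ℝ :=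
  (loopU p.2.1, tube (mfun (loopU p.2.1)) (toC (p.1 : EuclideanSpace ℝ (Fin 2))) (nprime p.2.2))

/-- **The handle-zone map** `TH = h ∘ GH`. [folklore] -/
def TH (p : sphere (0 : EuclideanSpace ℝ (Fin 2)) 1 × ℝ × ℂ) :
    sphere (0 : EuclideanSpace ℝ (Fin 3)) 1 × EuclideanSpace ℝ (Fin 2) :=
  handleMap (GH p)

/-- `m(u) ≥ 1/99`. [folklore] -/
theorem mfun_ge (u : ℝ) : 1 / 99 ≤ mfun u := by
  have h1 := (Kfun_mem u).1
  have h2 := Kfun_lt_one u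
  rw [mfun, le_div_iff₀ (by linarith)]
  linarith

/-- `GH` in terms of `ν`. [folklore] -/
theorem GH_eq {z : sphere (0 : EuclideanSpace ℝ (Fin 2)) 1} {t : ℝ} {ν : ℂ} (hν : |ν.im| < π) :
    GH (z, t, ν) = (loopU t,
      ↑(Real.sqrt (1 + qOf ν / mfun (loopU t))) * toC (z : EuclideanSpace ℝ (Fin 2)), ν.im) := by
  simp only [GH, tube_nprime _ hν]

/-- Bounds on the radius factor `√(1 + q/m) ∈ [0.9, 1.1]` on the thin tube. [folklore] -/
theorem sqrt_factor_mem {ν : ℂ} (hν : ‖ν‖ ≤ nuMax) (u : ℝ) :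
    9 / 10 ≤ Real.sqrt (1 + qOf ν / mfun u) ∧ Real.sqrt (1 + qOf ν / mfun u) ≤ 11 / 10 := by
  have hq := abs_qOf_le_thousandth hν
  obtain ⟨hq1, hq2⟩ := abs_le.1 hq
  have hm := mfun_ge u
  have hm0 : 0 < mfun u := mfun_pos u
  have h1 : -(1 / 10) ≤ qOf ν / mfun u := by rw [le_div_iff₀ hm0]; nlinarith
  have h2 : qOf ν / mfun u ≤ 1 / 10 := by rw [div_le_iff₀ hm0]; nlinarith
  constructor
  · rw [Real.le_sqrt (by norm_num) (by linarith)]; linarith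
  · rw [Real.sqrt_le_left (by norm_num)]; linarith

/-- The norm of the `ζ`-parameter of a handle-zone point. [folklore] -/
theorem norm_GH_snd_fst {z : sphere (0 : EuclideanSpace ℝ (Fin 2)) 1} {t : ℝ} {ν : ℂ} (hν : ‖ν‖ ≤ nuMax) :
    ‖(GH (z, t, ν)).2.1‖ = Real.sqrt (1 + qOf ν / mfun (loopU t)) := by
  rw [GH_eq (abs_im_lt_pi_of_le hν), norm_mul, Complex.norm_real, norm_toC_sphere, mul_one,
    Real.norm_of_nonneg (Real.sqrt_nonneg _)]

/-- **Handle-zone parameters lie in the box** `Ubox`. [folklore] -/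
theorem GH_mem_Ubox {z : sphere (0 : EuclideanSpace ℝ (Fin 2)) 1} {t : ℝ} {ν : ℂ} (ht : zoneH t)
    (hν : ‖ν‖ ≤ nuMax) : GH (z, t, ν) ∈ Ubox := by
  refine ⟨loopU_mem_Ioo ht.1 ht.2, ?_, ?_⟩
  · rw [norm_GH_snd_fst hν]; linarith [(sqrt_factor_mem hν (loopU t)).2]
  · rw [GH_eq (abs_im_lt_pi_of_le hν)]
    have := Complex.abs_im_le_norm ν; have := nuMax_le
    change |ν.im| < 23 / 10; linarith

/-- Handle-zone points are in the handle. [folklore] -/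
theorem TH_mem_Hset {z : sphere (0 : EuclideanSpace ℝ (Fin 2)) 1} {t : ℝ} {ν : ℂ} (ht : zoneH t)
    (hν : ‖ν‖ ≤ nuMax) : TH (z, t, ν) ∈ Hset := handleMap_mem_Hset (GH_mem_Ubox ht hν)

/-- The `ζ`-parameter is on the unknot iff `ν = 0`. [folklore] -/
theorem GH_snd_mem_unknot_iff {z : sphere (0 : EuclideanSpace ℝ (Fin 2)) 1} {t : ℝ} {ν : ℂ} (hν : ‖ν‖ ≤ nuMax) :
    (GH (z, t, ν)).2 ∈ UnknotSurgery.unknot ↔ ν = 0 := by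
  have h1 : ‖ν‖ ≤ 1 := by linarith [nuMax_le]
  have hn : ‖nprime ν‖ ≤ 1 / 1000 := by linarith [norm_nprime_le h1, nuMax_le]
  have hm := mfun_ge (loopU t)
  rw [GH, tube_mem_unknot_iff (mfun_pos _) (norm_toC_sphere z) (by linarith) (by linarith),
    nprime_eq_zero_iff (show ‖ν‖ < 1 by linarith [nuMax_le])]

/-- **The core of the handle zone**: `TH (z, t, 0) = h(loopU t, toC z, 0)`. [folklore] -/
theorem TH_zero (z : sphere (0 : EuclideanSpace ℝ (Fin 2)) 1) (t : ℝ) :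
    TH (z, t, 0) = handleMap (loopU t, toC (z : EuclideanSpace ℝ (Fin 2)), 0) := by
  rw [TH, GH_eq (by simp [pi_pos])]
  simp [qOf]

/-! ### The handle map as a partial diffeomorphism -/

/-- **The handle chart** `h : Ubox ≅ Hset` as a partial diffeomorphism. [folklore] -/
def handlePD : PartialDiffeomorph 𝓘(ℝ, ℝ × ℂ × ℝ) ((𝓡 2).prod 𝓘(ℝ, EuclideanSpace ℝ (Fin 2)))
    (ℝ × ℂ × ℝ) (sphere (0 : EuclideanSpace ℝ (Fin 3)) 1 × EuclideanSpace ℝ (Fin 2)) ∞ where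
  toFun := handleMap
  invFun := handleInv
  source := Ubox
  target := Hset
  map_source' := fun _ hu => handleMap_mem_Hset hu
  map_target' := fun _ hq => handleInv_mem_Ubox hq
  left_inv' := fun _ hu => handleInv_handleMap_of_mem hu
  right_inv' := fun _ hq => handleMap_handleInv_of_mem hq
  open_source := isOpen_Ubox
  open_target := isOpen_Hset
  contMDiffOn_toFun := fun _ hu => (contMDiffAt_handleMap_of_mem hu).contMDiffWithinAt
  contMDiffOn_invFun := fun _ hq => (contMDiffAt_handleInv_of_mem hq).contMDiffWithinAt

/-! ### The overlap identity with the graph zone -/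

/-- Numerical facts on the junction: for `√(49/50) < t` with `t² < 491/500` we have
`19/20 ≤ t ≤ 993/1000` and `0 < t`. [folklore] -/
theorem junction_bounds {t : ℝ} (h1 : Real.sqrt (49 / 50) < t) (h2 : zoneV t) :
    19 / 20 ≤ t ∧ t ≤ 993 / 1000 ∧ 0 < t ∧ 49 / 50 < t ^ 2 := by
  have hs : (19 / 20 : ℝ) ≤ Real.sqrt (49 / 50) := by
    rw [Real.le_sqrt (by norm_num) (by norm_num)]; norm_num
  have ht0 : 0 < t := by linarith
  have hsq : 49 / 50 < t ^ 2 := by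
    have := Real.sq_sqrt (show (0 : ℝ) ≤ 49 / 50 by norm_num)
    nlinarith [Real.sqrt_nonneg (49 / 50)]
  unfold zoneV at h2
  refine ⟨by linarith, ?_, ht0, hsq⟩
  nlinarith

/-- **On the junction the graph-zone fibre is the pure slice fibre**: `W = t² e^{i Im ν}` for
`√(49/50) < t`, `t² < 491/500`, `‖ν‖ ≤ ν_max`. [folklore] -/
theorem WV_junction {t : ℝ} {ν : ℂ} (h1 : Real.sqrt (49 / 50) < t) (h2 : zoneV t) (hν : ‖ν‖ ≤ nuMax) :
    WV t ν = ↑(t ^ 2) * Complex.exp (↑ν.im * Complex.I) := by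
  obtain ⟨ht1, ht2, ht0, hsq⟩ := junction_bounds h1 h2
  have hq := abs_qOf_le_thousandth hν
  obtain ⟨hqa, hqb⟩ := abs_le.1 hq
  have hS : SF t (qOf ν) = 1 - qOf ν := SF_of_sq_ge (η := t) (by linarith) (qOf ν)
  have hS0 : 0 < 1 - qOf ν := by linarith
  have hξ : xiV t ν = t * Real.sqrt (1 - qOf ν) := by rw [xiV, XiF, hS]
  have hX : XV t ν = 1 - t ^ 2 + t ^ 2 * qOf ν := by
    rw [XV, hξ, mul_pow, Real.sq_sqrt hS0.le]; ring
  have hX10 : XV t ν ≤ 1 / 10 := by unfold zoneV at h2; rw [hX]; nlinarith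
  have hg : IwasePolar.gprof (XV t ν) = 1 - XV t ν := IwasePolar.gprof_of_le hX10
  have hε : epsF (XV t ν) = 1 - XV t ν := epsF_of_le hX10
  rw [WV, hg, hε]
  have h1q : (1 : ℂ) - ↑(qOf ν) = Complex.exp (-(ν.re : ℂ)) := by
    rw [qOf]; push_cast; ring
  have hexp : Complex.exp ν = Complex.exp (ν.re : ℂ) * Complex.exp (↑ν.im * Complex.I) := by
    rw [← Complex.exp_add, ← Complex.re_add_im ν]; simp
  calc (↑(1 - XV t ν) : ℂ) + ↑(1 - XV t ν) * (Complex.exp ν - 1)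
      = ↑(1 - XV t ν) * Complex.exp ν := by ring
    _ = ↑(t ^ 2) * ((1 : ℂ) - ↑(qOf ν)) * Complex.exp ν := by rw [hX]; push_cast; ring
    _ = ↑(t ^ 2) * Complex.exp (↑ν.im * Complex.I) := by
        rw [h1q, hexp, mul_assoc, ← mul_assoc (Complex.exp _), ← Complex.exp_add, neg_add_cancel,
          Complex.exp_zero, one_mul]

/-- **The overlap identity**: on the junction `√(49/50) < t`, `t² < 491/500` the handle-zone map
and the graph-zone map agree, `TH = TV` (the handle chart at its north end is the cylindrical
chart with `k² = 1 - t²`, `k² ρ² = X`, slice radius `t²`, and the graph-zone fibre there is the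
pure slice fibre `W = t² e^{i Im ν}`). [folklore] -/
theorem TH_eq_TV {z : sphere (0 : EuclideanSpace ℝ (Fin 2)) 1} {t : ℝ} {ν : ℂ}
    (h1 : Real.sqrt (49 / 50) < t) (h2 : zoneV t) (hν : ‖ν‖ ≤ nuMax) : TH (z, t, ν) = TV (z, t, ν) := by
  obtain ⟨ht1, ht2, ht0, hsq⟩ := junction_bounds h1 h2
  have hπν := abs_im_lt_pi_of_le hν
  set u := loopU t with hu
  have hu0 : 0 ≤ u := by rw [hu, loopU_eq_sigN ht1 (by linarith)]; exact sigN_nonneg hsq.le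
  have hu1 : u ≤ 1 / 500 := loopU_le_of_le ht1 ht2
  have hu10 : u ≤ 1 / 10 := by linarith
  have htan : tan (π * u) = t ^ 2 - 49 / 50 := tan_pi_mul_loopU ht1 (by linarith)
  have hK : Kfun u = 1 - t ^ 2 := by rw [Kfun_eq_of_le hu0 hu1, htan]; ring
  -- the fibre data of the graph zone at the junction: `μ = 1`
  have hx0 : 1 - t ^ 2 ≤ 1 / 25 := by linarith
  have hq := abs_qOf_le_thousandth hν
  obtain ⟨hqa, hqb⟩ := abs_le.1 hq
  have hS : SF t (qOf ν) = 1 - qOf ν := SF_of_sq_ge (η := t) (by linarith) (qOf ν)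
  have hS0 : 0 < 1 - qOf ν := by linarith
  have hξ : xiV t ν = t * Real.sqrt (1 - qOf ν) := by rw [xiV, XiF, hS]
  have hX : XV t ν = 1 - t ^ 2 + t ^ 2 * qOf ν := by
    rw [XV, hξ, mul_pow, Real.sq_sqrt hS0.le]; ring
  have hX10 : XV t ν ≤ 1 / 10 := by rw [hX]; nlinarith
  have hW : WV t ν = ↑(t ^ 2) * Complex.exp (↑ν.im * Complex.I) := WV_junction h1 h2 hν
  -- the handle data
  have hm : mfun u = (1 - t ^ 2) / t ^ 2 := by
    rw [mfun, hK]; ring_nf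
  set ρ := Real.sqrt (1 + qOf ν / mfun u) with hρ
  have h1q : 0 ≤ 1 + qOf ν / mfun u := by
    have := mfun_ge u; have h0 := mfun_pos u
    have : -(1 / 10) ≤ qOf ν / mfun u := by rw [le_div_iff₀ h0]; nlinarith
    linarith
  have hρsq : ρ ^ 2 = 1 + qOf ν / mfun u := Real.sq_sqrt h1q
  have hζ : ‖(↑ρ : ℂ) * toC (z : EuclideanSpace ℝ (Fin 2))‖ ≤ 5 / 2 := by
    rw [norm_mul, Complex.norm_real, norm_toC_sphere, mul_one, Real.norm_of_nonneg (Real.sqrt_nonneg _)]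
    linarith [(sqrt_factor_mem hν u).2]
  have hx00 : (1 : ℝ) - t ^ 2 ≠ 0 := by unfold zoneV at h2; exact ne_of_gt (by linarith)
  have hkρ : kfun u ^ 2 * ρ ^ 2 = XV t ν := by
    rw [kfun_sq, hK, hρsq, hm, hX]
    field_simp
  have hkρ' : kfun u * ρ = Real.sqrt (XV t ν) := by
    rw [← hkρ, ← mul_pow, Real.sqrt_sq (mul_nonneg (kfun_pos u).le (Real.sqrt_nonneg _))]
  have hXI : xiV t ν = Real.sqrt (1 - XV t ν) := by
    rw [XV, sub_sub_cancel, Real.sqrt_sq]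
    rw [hξ]; exact mul_nonneg ht0.le (Real.sqrt_nonneg _)
  have h1X : Real.sqrt (1 - xiV t ν ^ 2) = Real.sqrt (XV t ν) := by rw [XV]
  -- compare
  rw [TH, GH_eq hπν, TV]
  refine Prod.ext ?_ ?_
  · apply Subtype.ext
    rw [handleMap_coe_fst_of_le hu0 hu10 hζ, coe_cylPt z (xiV_mem_Icc h2 hν)]
    have hn2 : ‖(↑ρ : ℂ) * toC (z : EuclideanSpace ℝ (Fin 2))‖ ^ 2 = ρ ^ 2 := by
      rw [norm_mul, Complex.norm_real, norm_toC_sphere, mul_one, Real.norm_of_nonneg (Real.sqrt_nonneg _)]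
    have h3 : Real.sqrt (1 - kfun u ^ 2 * ‖(↑ρ : ℂ) * toC (z : EuclideanSpace ℝ (Fin 2))‖ ^ 2) = xiV t ν := by
      rw [hn2, hkρ, hXI]
    ext i
    fin_cases i
    · simp [toC, h1X, ← hkρ']; ring
    · simp [toC, h1X, ← hkρ']; ring
    · simpa using h3
  · rw [handleMap_snd_of_le hu0 hu10 hζ, htan, hW, wOf]
    norm_num


/-! ### The handle parameters as a partial diffeomorphism; local diffeomorphism property -/

/-- The circle point of `toC z` is `z`. [folklore] -/
theorem circleOf_toC (z : sphere (0 : EuclideanSpace ℝ (Fin 2)) 1) :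
    IwasePolar.circleOf (toC (z : EuclideanSpace ℝ (Fin 2))) = z := by
  apply Subtype.ext
  rw [IwasePolar.coe_circleOf (norm_toC_sphere z), IwasePolar.toE_toC]

/-- The circle point of `nrm` of a positive multiple of `toC z` is `z`. [folklore] -/
theorem circleOf_nrm_mul_toC {r : ℝ} (hr : 0 < r) (z : sphere (0 : EuclideanSpace ℝ (Fin 2)) 1) :
    IwasePolar.circleOf (nrm (↑r * toC (z : EuclideanSpace ℝ (Fin 2)))) = z := by
  rw [nrm_ofReal_mul hr, nrm_of_norm_eq_one (norm_toC_sphere z), circleOf_toC]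

/-- `‖z‖ · nrm z = z`. [folklore] -/
theorem ofReal_norm_mul_nrm {z : ℂ} (hz : z ≠ 0) : (‖z‖ : ℂ) * nrm z = z := by
  have hn : ‖z‖ ≠ 0 := norm_ne_zero_iff.2 hz
  apply Complex.ext
  · simp [nrm_re]; field_simp
  · simp [nrm_im]; field_simp

/-- The recovered real part of the fibre coordinate: `a = -log (1 - m(u)(‖ζ‖² - 1))`. [folklore] -/
def aRec (u : ℝ) (ζ : ℂ) : ℝ := -Real.log (1 - mfun u * (‖ζ‖ ^ 2 - 1))

/-- The recovered fibre coordinate `ν = a + i c`. [folklore] -/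
def nuRec (w : ℝ × ℂ × ℝ) : ℂ := ↑(aRec w.1 w.2.1) + ↑w.2.2 * Complex.I

/-- Real and imaginary parts of `nuRec`. [folklore] -/
@[simp] theorem nuRec_re (w : ℝ × ℂ × ℝ) : (nuRec w).re = aRec w.1 w.2.1 := by simp [nuRec]

/-- Real and imaginary parts of `nuRec`. [folklore] -/
@[simp] theorem nuRec_im (w : ℝ × ℂ × ℝ) : (nuRec w).im = w.2.2 := by simp [nuRec]

/-- **The inverse of the handle parameters**: `(u, ζ, c) ↦ (ζ/‖ζ‖, loopT u, a + ic)`. [folklore] -/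
def GHinv (w : ℝ × ℂ × ℝ) : sphere (0 : EuclideanSpace ℝ (Fin 2)) 1 × ℝ × ℂ :=
  (IwasePolar.circleOf (nrm w.2.1), loopT w.1, nuRec w)

/-- The source of the handle-parameter chart: `‖ν‖ < ν_max`. [folklore] -/
def GHsrc : Set (sphere (0 : EuclideanSpace ℝ (Fin 2)) 1 × ℝ × ℂ) := {p | ‖p.2.2‖ < nuMax}

/-- The target of the handle-parameter chart. [folklore] -/
def GHtgt : Set (ℝ × ℂ × ℝ) :=
  {w | w.2.1 ≠ 0 ∧ mfun w.1 * (‖w.2.1‖ ^ 2 - 1) < 1 ∧ ‖nuRec w‖ < nuMax}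

/-- The source is open. [folklore] -/
theorem isOpen_GHsrc : IsOpen GHsrc :=
  isOpen_lt (continuous_norm.comp (continuous_snd.comp continuous_snd)) continuous_const

/-- `aRec` is smooth where `1 - m(u)(‖ζ‖² - 1) > 0`. [folklore] -/
theorem contDiffAt_aRec {w : ℝ × ℂ} (hw : mfun w.1 * (‖w.2‖ ^ 2 - 1) < 1) :
    ContDiffAt ℝ ∞ (fun w : ℝ × ℂ => aRec w.1 w.2) w := by
  unfold aRec
  have h : ContDiffAt ℝ ∞ (fun w : ℝ × ℂ => 1 - mfun w.1 * (‖w.2‖ ^ 2 - 1)) w :=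
    contDiffAt_const.sub ((contDiff_mfun.contDiffAt.comp w contDiffAt_fst).mul
      (((contDiffAt_id.norm_sq ℝ).comp w contDiffAt_snd).sub contDiffAt_const))
  exact (h.log (by linarith)).neg

/-- `nuRec` is smooth where `1 - m(u)(‖ζ‖² - 1) > 0`. [folklore] -/
theorem contDiffAt_nuRec {w : ℝ × ℂ × ℝ} (hw : mfun w.1 * (‖w.2.1‖ ^ 2 - 1) < 1) : ContDiffAt ℝ ∞ nuRec w := by
  have h1 : ContDiffAt ℝ ∞ (fun w : ℝ × ℂ × ℝ => aRec w.1 w.2.1) w := by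
    have := (contDiffAt_aRec (w := (w.1, w.2.1)) hw).comp w
      (contDiffAt_fst.prodMk (contDiffAt_fst.comp w contDiffAt_snd))
    exact this
  have h2 : ContDiffAt ℝ ∞ (fun w : ℝ × ℂ × ℝ => ((aRec w.1 w.2.1 : ℝ) : ℂ)) w := by
    have := Complex.ofRealCLM.contDiff.contDiffAt.comp w h1
    exact this
  have h3 : ContDiffAt ℝ ∞ (fun w : ℝ × ℂ × ℝ => ((w.2.2 : ℝ) : ℂ)) w :=
    (Complex.ofRealCLM.contDiff.comp (contDiff_snd.comp contDiff_snd)).contDiffAt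
  have h4 := h2.add (h3.mul (contDiffAt_const (c := Complex.I)))
  exact h4

/-- The target is open. [folklore] -/
theorem isOpen_GHtgt : IsOpen GHtgt := by
  rw [isOpen_iff_mem_nhds]
  rintro w ⟨h0, h1, h2⟩
  have hc : Continuous fun w : ℝ × ℂ × ℝ => mfun w.1 * (‖w.2.1‖ ^ 2 - 1) := by
    have := contDiff_mfun.continuous; fun_prop
  have e0 : ∀ᶠ w' : ℝ × ℂ × ℝ in 𝓝 w, w'.2.1 ≠ 0 :=
    (continuous_fst.comp continuous_snd).continuousAt.eventually_ne h0
  have e1 : ∀ᶠ w' : ℝ × ℂ × ℝ in 𝓝 w, mfun w'.1 * (‖w'.2.1‖ ^ 2 - 1) < 1 :=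
    hc.continuousAt.eventually_lt continuousAt_const h1
  have e2 : ∀ᶠ w' : ℝ × ℂ × ℝ in 𝓝 w, ‖nuRec w'‖ < nuMax :=
    (continuous_norm.continuousAt.comp (contDiffAt_nuRec h1).continuousAt).eventually_lt
      continuousAt_const h2
  filter_upwards [e0, e1, e2] with w' a b c
  exact ⟨a, b, c⟩

/-- On the source, `m(u)(ρ² - 1) = q`. [folklore] -/
theorem mfun_mul_rhoSq_sub_one {ν : ℂ} (hν : ‖ν‖ ≤ nuMax) (u : ℝ) :
    mfun u * (Real.sqrt (1 + qOf ν / mfun u) ^ 2 - 1) = qOf ν := by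
  have hm0 := mfun_pos u
  have hpos : 0 ≤ 1 + qOf ν / mfun u := by
    have := (sqrt_factor_mem hν u).1
    by_contra h; push Not at h
    rw [Real.sqrt_eq_zero'.2 h.le] at this; norm_num at this
  rw [Real.sq_sqrt hpos]; field_simp; ring

/-- `GHinv ∘ GH = id` on the source. [folklore] -/
theorem GHinv_GH {z : sphere (0 : EuclideanSpace ℝ (Fin 2)) 1} {t : ℝ} {ν : ℂ} (hν : ‖ν‖ ≤ nuMax) :
    GHinv (GH (z, t, ν)) = (z, t, ν) := by
  have hρ := (sqrt_factor_mem hν (loopU t)).1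
  rw [GH_eq (abs_im_lt_pi_of_le hν), GHinv]
  simp only
  rw [circleOf_nrm_mul_toC (by linarith) z, loopT_loopU]
  congr 2
  apply Complex.ext
  · rw [nuRec_re, aRec, norm_mul, Complex.norm_real, norm_toC_sphere, mul_one,
      Real.norm_of_nonneg (Real.sqrt_nonneg _), mfun_mul_rhoSq_sub_one hν, qOf, sub_sub_cancel,
      Real.log_exp, neg_neg]
  · rw [nuRec_im]

/-- `q` of the recovered coordinate. [folklore] -/
theorem qOf_nuRec {w : ℝ × ℂ × ℝ} (hw : mfun w.1 * (‖w.2.1‖ ^ 2 - 1) < 1) :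
    qOf (nuRec w) = mfun w.1 * (‖w.2.1‖ ^ 2 - 1) := by
  rw [qOf, nuRec_re, aRec, neg_neg, Real.exp_log (by linarith)]; ring

/-- `GH ∘ GHinv = id` on the target. [folklore] -/
theorem GH_GHinv {w : ℝ × ℂ × ℝ} (hw : w ∈ GHtgt) : GH (GHinv w) = w := by
  obtain ⟨u, ζ, c⟩ := w
  obtain ⟨h0, h1, h2⟩ := hw
  simp only at h0 h1 h2
  have hπ : |(nuRec (u, ζ, c)).im| < π := abs_im_lt_pi_of_le h2.le
  rw [GHinv, GH_eq hπ]
  simp only [loopU_loopT, nuRec_im]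
  have hq : qOf (nuRec (u, ζ, c)) = mfun u * (‖ζ‖ ^ 2 - 1) := qOf_nuRec (w := (u, ζ, c)) h1
  have hρ : Real.sqrt (1 + qOf (nuRec (u, ζ, c)) / mfun u) = ‖ζ‖ := by
    rw [hq, mul_div_cancel_left₀ _ (mfun_pos u).ne', add_sub_cancel, Real.sqrt_sq (norm_nonneg _)]
  rw [hρ, IwasePolar.toC_circleOf (norm_nrm h0), ofReal_norm_mul_nrm h0]

/-- `GH` maps the source into the target. [folklore] -/
theorem GH_mem_GHtgt {z : sphere (0 : EuclideanSpace ℝ (Fin 2)) 1} {t : ℝ} {ν : ℂ} (hν : ‖ν‖ < nuMax) :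
    GH (z, t, ν) ∈ GHtgt := by
  have hρ := (sqrt_factor_mem hν.le (loopU t)).1
  have hq := abs_qOf_le_thousandth hν.le
  have hinv := GHinv_GH (z := z) (t := t) hν.le
  rw [GHinv, Prod.mk.injEq, Prod.mk.injEq] at hinv
  refine ⟨?_, ?_, ?_⟩
  · rw [GH_eq (abs_im_lt_pi_of_le hν.le)]
    exact mul_ne_zero (Complex.ofReal_ne_zero.2 (by linarith)) (by
      rw [← norm_ne_zero_iff, norm_toC_sphere]; exact one_ne_zero)
  · rw [norm_GH_snd_fst hν.le]
    change mfun (loopU t) * _ < 1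
    rw [mfun_mul_rhoSq_sub_one hν.le]
    linarith [(abs_le.1 hq).2]
  · rw [hinv.2.2]; exact hν

/-- `GH` is smooth on the source. [folklore] -/
theorem contMDiffAt_GH {p : sphere (0 : EuclideanSpace ℝ (Fin 2)) 1 × ℝ × ℂ} (hp : ‖p.2.2‖ < nuMax) :
    ContMDiffAt ((𝓡 1).prod 𝓘(ℝ, ℝ × ℂ)) 𝓘(ℝ, ℝ × ℂ × ℝ) ∞ GH p := by
  -- replace `GH` by its explicit formula near `p`
  have hev : GH =ᶠ[𝓝 p] fun p : sphere (0 : EuclideanSpace ℝ (Fin 2)) 1 × ℝ × ℂ =>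
      (loopU p.2.1, ↑(Real.sqrt (1 + qOf p.2.2 / mfun (loopU p.2.1))) *
        toC (p.1 : EuclideanSpace ℝ (Fin 2)), p.2.2.im) := by
    have ho : IsOpen {p : sphere (0 : EuclideanSpace ℝ (Fin 2)) 1 × ℝ × ℂ | ‖p.2.2‖ < nuMax} := isOpen_GHsrc
    filter_upwards [ho.mem_nhds hp] with q hq
    obtain ⟨z, t, ν⟩ := q
    exact GH_eq (abs_im_lt_pi_of_le (le_of_lt hq))
  refine ContMDiffAt.congr_of_eventuallyEq ?_ hev
  -- smoothness of the scalar data in `(t, ν)`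
  have hpos : 0 < 1 + qOf p.2.2 / mfun (loopU p.2.1) := by
    linarith [(sqrt_factor_mem hp.le (loopU p.2.1)).1, Real.sqrt_pos.1
      (by linarith [(sqrt_factor_mem hp.le (loopU p.2.1)).1] : 0 < Real.sqrt (1 + qOf p.2.2 / mfun (loopU p.2.1)))]
  have hq : ContDiff ℝ ∞ fun ν : ℂ => qOf ν := by
    unfold qOf; exact contDiff_const.sub (Real.contDiff_exp.comp (Complex.reCLM.contDiff.neg))
  have hR : ContDiffAt ℝ ∞ (fun q : ℝ × ℂ => Real.sqrt (1 + qOf q.2 / mfun (loopU q.1))) p.2 := by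
    refine ContDiffAt.sqrt ?_ hpos.ne'
    exact contDiffAt_const.add ((hq.contDiffAt.comp _ contDiffAt_snd).div
      (contDiff_mfun.contDiffAt.comp _ (contDiff_loopU.contDiffAt.comp _ contDiffAt_fst)) (mfun_pos _).ne')
  have h2 : ContMDiffAt ((𝓡 1).prod 𝓘(ℝ, ℝ × ℂ)) 𝓘(ℝ, ℝ × ℂ) ∞
      (fun p : sphere (0 : EuclideanSpace ℝ (Fin 2)) 1 × ℝ × ℂ => p.2) p := contMDiffAt_snd
  have hu : ContMDiffAt ((𝓡 1).prod 𝓘(ℝ, ℝ × ℂ)) 𝓘(ℝ, ℝ) ∞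
      (fun p : sphere (0 : EuclideanSpace ℝ (Fin 2)) 1 × ℝ × ℂ => loopU p.2.1) p :=
    ((contDiff_loopU.comp contDiff_fst).contMDiff.contMDiffAt).comp p h2
  have hRC : ContMDiffAt ((𝓡 1).prod 𝓘(ℝ, ℝ × ℂ)) 𝓘(ℝ, ℂ) ∞
      (fun p : sphere (0 : EuclideanSpace ℝ (Fin 2)) 1 × ℝ × ℂ =>
        (↑(Real.sqrt (1 + qOf p.2.2 / mfun (loopU p.2.1))) : ℂ)) p :=
    ((Complex.ofRealCLM.contDiff.contDiffAt.comp _ hR).contMDiffAt).comp p h2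
  have hz : ContMDiffAt ((𝓡 1).prod 𝓘(ℝ, ℝ × ℂ)) 𝓘(ℝ, ℂ) ∞
      (fun p : sphere (0 : EuclideanSpace ℝ (Fin 2)) 1 × ℝ × ℂ => toC (p.1 : EuclideanSpace ℝ (Fin 2))) p :=
    contMDiff_toC.contMDiffAt.comp p contMDiffAt_fst
  have him : ContMDiffAt ((𝓡 1).prod 𝓘(ℝ, ℝ × ℂ)) 𝓘(ℝ, ℝ) ∞
      (fun p : sphere (0 : EuclideanSpace ℝ (Fin 2)) 1 × ℝ × ℂ => p.2.2.im) p :=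
    ((Complex.imCLM.contDiff.comp contDiff_snd).contMDiff.contMDiffAt).comp p h2
  have hmul : ContMDiffAt ((𝓡 1).prod 𝓘(ℝ, ℝ × ℂ)) 𝓘(ℝ, ℂ) ∞
      (fun p : sphere (0 : EuclideanSpace ℝ (Fin 2)) 1 × ℝ × ℂ =>
        (↑(Real.sqrt (1 + qOf p.2.2 / mfun (loopU p.2.1))) : ℂ) * toC (p.1 : EuclideanSpace ℝ (Fin 2))) p := by
    have := ((contDiff_mul (𝔸 := ℂ) (𝕜 := ℝ) (n := ∞)).contMDiff.contMDiffAt).comp p (hRC.prodMk_space hz)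
    exact this
  exact hu.prodMk_space (hmul.prodMk_space him)

/-- `GHinv` is smooth on the target. [folklore] -/
theorem contMDiffAt_GHinv {w : ℝ × ℂ × ℝ} (hw : w ∈ GHtgt) :
    ContMDiffAt 𝓘(ℝ, ℝ × ℂ × ℝ) ((𝓡 1).prod 𝓘(ℝ, ℝ × ℂ)) ∞ GHinv w := by
  obtain ⟨h0, h1, _⟩ := hw
  have hn : nrm w.2.1 ≠ 0 := nrm_ne_zero h0
  have hc : ContMDiffAt 𝓘(ℝ, ℝ × ℂ × ℝ) (𝓡 1) ∞ (fun w : ℝ × ℂ × ℝ => IwasePolar.circleOf (nrm w.2.1)) w := by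
    have h1 : ContDiffAt ℝ ∞ (fun w : ℝ × ℂ × ℝ => nrm w.2.1) w :=
      ContDiffAt.comp (f := fun w : ℝ × ℂ × ℝ => w.2.1) w (contDiffAt_nrm h0)
        (contDiffAt_fst.comp w contDiffAt_snd)
    have := (IwasePolar.contMDiffAt_circleOf hn).comp w h1.contMDiffAt
    exact this
  have ht : ContDiffAt ℝ ∞ (fun w : ℝ × ℂ × ℝ => loopT w.1) w := contDiff_loopT.contDiffAt.comp w contDiffAt_fst
  exact hc.prodMk ((ht.prodMk (contDiffAt_nuRec h1)).contMDiffAt)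

/-- **The handle parameters as a partial diffeomorphism.** [folklore] -/
def GHPD : PartialDiffeomorph ((𝓡 1).prod 𝓘(ℝ, ℝ × ℂ)) 𝓘(ℝ, ℝ × ℂ × ℝ)
    (sphere (0 : EuclideanSpace ℝ (Fin 2)) 1 × ℝ × ℂ) (ℝ × ℂ × ℝ) ∞ where
  toFun := GH
  invFun := GHinv
  source := GHsrc
  target := GHtgt
  map_source' := by rintro ⟨z, t, ν⟩ hp; exact GH_mem_GHtgt hp
  map_target' := fun _ hw => hw.2.2
  left_inv' := by rintro ⟨z, t, ν⟩ hp; exact GHinv_GH (le_of_lt hp)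
  right_inv' := fun _ hw => GH_GHinv hw
  open_source := isOpen_GHsrc
  open_target := isOpen_GHtgt
  contMDiffOn_toFun := fun _ hp => (contMDiffAt_GH hp).contMDiffWithinAt
  contMDiffOn_invFun := fun _ hw => (contMDiffAt_GHinv hw).contMDiffWithinAt

/-- **The handle-zone map is a local diffeomorphism** on the handle zone, `‖ν‖ < ν_max`.
[folklore] -/
theorem isLocalDiffeomorphAt_TH {p : sphere (0 : EuclideanSpace ℝ (Fin 2)) 1 × ℝ × ℂ}
    (ht : zoneH p.2.1) (hν : ‖p.2.2‖ < nuMax) :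
    IsLocalDiffeomorphAt ((𝓡 1).prod 𝓘(ℝ, ℝ × ℂ)) ((𝓡 2).prod 𝓘(ℝ, EuclideanSpace ℝ (Fin 2))) ∞ TH p := by
  have h1 := GHPD.isLocalDiffeomorphAt _ _ _ (show p ∈ GHsrc from hν)
  have hmem : GH p ∈ handlePD.source := by
    obtain ⟨z, t, ν⟩ := p
    exact GH_mem_Ubox ht hν.le
  have h2 := handlePD.isLocalDiffeomorphAt _ _ _ hmem
  exact IsLocalDiffeomorphAt.comp (hf := h1) (hg := h2)

/-- `TH` is smooth on the handle zone. [folklore] -/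
theorem contMDiffAt_TH {p : sphere (0 : EuclideanSpace ℝ (Fin 2)) 1 × ℝ × ℂ}
    (ht : zoneH p.2.1) (hν : ‖p.2.2‖ < nuMax) :
    ContMDiffAt ((𝓡 1).prod 𝓘(ℝ, ℝ × ℂ)) ((𝓡 2).prod 𝓘(ℝ, EuclideanSpace ℝ (Fin 2))) ∞ TH p :=
  (isLocalDiffeomorphAt_TH ht hν).contMDiffAt

/-- `TV` is smooth on the graph zone. [folklore] -/
theorem contMDiffAt_TV {p : sphere (0 : EuclideanSpace ℝ (Fin 2)) 1 × ℝ × ℂ}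
    (ht : zoneV p.2.1) (hν : ‖p.2.2‖ < nuMax) :
    ContMDiffAt ((𝓡 1).prod 𝓘(ℝ, ℝ × ℂ)) ((𝓡 2).prod 𝓘(ℝ, EuclideanSpace ℝ (Fin 2))) ∞ TV p :=
  (isLocalDiffeomorphAt_TV (xiV_mem_Ioo ht hν.le) hν).contMDiffAt

/-! ### Exactness on the handle zone -/

/-- **The correcting rotation of the handle zone**: the circle point of `(nrm (e^{-ν} E(ν)))⁻¹`.
[folklore] -/
def rotH (ν : ℂ) : sphere (0 : EuclideanSpace ℝ (Fin 2)) 1 :=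
  IwasePolar.circleOf (nrm (Complex.exp (-ν) * Efun ν))⁻¹

/-- `rotH 0 = 1`. [folklore] -/
@[simp] theorem rotH_zero : rotH 0 = circlePoint 0 := by
  rw [rotH, neg_zero, Complex.exp_zero, one_mul, Efun_zero, nrm_of_norm_eq_one (by simp), inv_one]
  apply Subtype.ext
  rw [IwasePolar.coe_circleOf (by simp)]
  ext i; fin_cases i <;> simp [circlePoint]

/-- `rotH` is smooth on `‖ν‖ < 1`. [folklore] -/
theorem contMDiffAt_rotH {ν : ℂ} (hν : ‖ν‖ < 1) : ContMDiffAt 𝓘(ℝ, ℂ) (𝓡 1) ∞ rotH ν := by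
  have hF : Complex.exp (-ν) * Efun ν ≠ 0 := mul_ne_zero (Complex.exp_ne_zero _) (Efun_ne_zero hν)
  have hn : nrm (Complex.exp (-ν) * Efun ν) ≠ 0 := nrm_ne_zero hF
  have hsm : ContDiffAt ℝ ∞ (fun ν : ℂ => Complex.exp (-ν) * Efun ν) ν :=
    ((Complex.contDiff_exp (𝕜 := ℝ)).comp contDiff_neg).contDiffAt.mul contDiff_Efun.contDiffAt
  have h1 : ContDiffAt ℝ ∞ (fun ν => (nrm (Complex.exp (-ν) * Efun ν))⁻¹) ν :=
    (ContDiffAt.comp (f := fun ν : ℂ => Complex.exp (-ν) * Efun ν) ν (contDiffAt_nrm hF) hsm).inv hn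
  exact (IwasePolar.contMDiffAt_circleOf (inv_ne_zero hn)).comp ν h1.contMDiffAt

/-- **The untwisted handle-zone map** `TH₁ (z, t, ν) = G⁻¹ (TH (rotH(ν) · z, t, ν))`, the formula of
the second torus over the handle zone. [folklore] -/
def TH1 (p : sphere (0 : EuclideanSpace ℝ (Fin 2)) 1 × ℝ × ℂ) :
    sphere (0 : EuclideanSpace ℝ (Fin 3)) 1 × EuclideanSpace ℝ (Fin 2) :=
  gluckMapInv (TH (circleMul (rotH p.2.2) p.1, p.2.1, p.2.2))

/-- On the core `TH₁ = G⁻¹ ∘ TH`. [folklore] -/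
theorem TH1_zero (z : sphere (0 : EuclideanSpace ℝ (Fin 2)) 1) (t : ℝ) :
    TH1 (z, t, 0) = gluckMapInv (TH (z, t, 0)) := by
  simp [TH1]

/-- **Exactness of the handle model on the handle-zone tube**: `Φ_H` sends the sheared tube point
`TH (unit(v) · z, t, ν(v))` to `TH₁ (z, t, ν(v))`.  This is `theta_tube` (the exact tube relation
of the slice model) transported by the handle chart: the shear `unit(v) = nrm ν = (nrm F)⁻¹ nrm n'`
(`n' = ν F`, `F = e^{-ν} E(ν)`) is undone by `Θ` up to the smooth rotation `rotH = (nrm F)⁻¹`.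
[folklore] -/
theorem PhiH_TH_shear {z : sphere (0 : EuclideanSpace ℝ (Fin 2)) 1} {t : ℝ} (ht : zoneH t)
    {v : EuclideanSpace ℝ (Fin 2)} (hv : v ≠ 0) :
    PhiH (TH (circleMul (unitVector₀ v) z, t, nuOfV v)) = TH1 (z, t, nuOfV v) := by
  set ν := nuOfV v with hν_def
  have hν : ‖ν‖ ≤ nuMax := (norm_nuOfV_lt v).le
  have hν1 : ‖ν‖ < 1 := by linarith [nuMax_le]
  have hν0 : ν ≠ 0 := fun h => hv (nuOfV_eq_zero_iff.1 h)
  set F := Complex.exp (-ν) * Efun ν with hF_def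
  have hF : F ≠ 0 := mul_ne_zero (Complex.exp_ne_zero _) (Efun_ne_zero hν1)
  have hn' : nprime ν = ν * F := nprime_eq ν
  have hn'0 : nprime ν ≠ 0 := by rw [hn']; exact mul_ne_zero hν0 hF
  have hnrm : nrm (nprime ν) = nrm ν * nrm F := by rw [hn', nrm_mul]
  have hshear : unitVector₀ v = IwasePolar.circleOf (nrm ν) := by
    rw [hν_def, nrm_nuOfV, IwasePolar.circleOf_nrm_toC hv]
  have hunitν : ‖nrm ν‖ = 1 := norm_nrm hν0
  have hunitF : ‖(nrm F)⁻¹‖ = 1 := by rw [norm_inv, norm_nrm hF, inv_one]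
  -- sizes for `theta_tube`
  have hm := mfun_ge (loopU t)
  have hnle : ‖nprime ν‖ ≤ 1 / 1000 := by linarith [norm_nprime_le hν1.le, nuMax_le]
  -- the two `ζ`-parameters
  have hz1 : toC ((circleMul (unitVector₀ v) z : sphere (0 : EuclideanSpace ℝ (Fin 2)) 1) : EuclideanSpace ℝ (Fin 2)) =
      (toC (z : EuclideanSpace ℝ (Fin 2)) * (nrm F)⁻¹) * nrm (nprime ν) := by
    rw [toC_circleMul, hshear, IwasePolar.toC_circleOf hunitν, hnrm]
    field_simp [nrm_ne_zero hF]
  have hz2 : toC ((circleMul (rotH ν) z : sphere (0 : EuclideanSpace ℝ (Fin 2)) 1) : EuclideanSpace ℝ (Fin 2)) =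
      toC (z : EuclideanSpace ℝ (Fin 2)) * (nrm F)⁻¹ := by
    rw [toC_circleMul, rotH, IwasePolar.toC_circleOf hunitF, mul_comm]
  have hzn : ‖toC (z : EuclideanSpace ℝ (Fin 2)) * (nrm F)⁻¹‖ = 1 := by
    rw [norm_mul, norm_toC_sphere, hunitF, mul_one]
  have hΘ : theta (prof (loopU t)) cutoff (tube (mfun (loopU t))
      (toC ((circleMul (unitVector₀ v) z : sphere (0 : EuclideanSpace ℝ (Fin 2)) 1) : EuclideanSpace ℝ (Fin 2)))
      (nprime ν)) = tube (mfun (loopU t))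
      (toC ((circleMul (rotH ν) z : sphere (0 : EuclideanSpace ℝ (Fin 2)) 1) : EuclideanSpace ℝ (Fin 2))) (nprime ν) := by
    rw [hz1, hz2]
    exact theta_tube (prof_tubeAdapted (loopU t)) hzn (by linarith) (by linarith) hn'0
  rw [TH, PhiH_handleMap (GH_mem_Ubox ht hν), TH1]
  simp only
  rw [TH]
  congr 2
  simp only [GH, ThetaS, hΘ]

end IwaseTori
end Literature.Topology.FourManifolds
end
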